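import Mathlib.Analysis.SpecialFunctions.Pow.Real
import Mathlib.Analysis.SpecialFunctions.Log.Basic
import Mathlib.Analysis.SpecialFunctions.Sqrt
import Mathlib.Analysis.Complex.ExponentialBounds
import Mathlib.Algebra.Order.Floor.Defs
import HarnessLib

/-!
# Roy–Waldschmidt 1997, §5: the parameters of the proof of Théorème 5.1 and inequality (5.3)

D. Roy, M. Waldschmidt, Ann. Sci. ÉNS (4) 30 (1997) 753–796, proof of Théorème 5.1, pp. 781–784.
With `κ ≥ c` "très grand" and a place of degree `D ≥ exp(exp κ)`, the parameters are (p. 781)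

`S₀ = T₀ = [κD/((log κ)(log D))]`, `T₁ = ⋯ = T_{d₁} = [((log κ)^d κ^{n-d₀} (log D)^{d₀-n} D^{2n-d₀})^{1/d₁}]`,
`S₁ = ⋯ = S_{ℓ_a} = [κD/((log κ)² T₁)]`, `S_{ℓ_a+1} = ⋯ = S_{ℓ₁} = [D/((log κ)² T₁)]`.

Théorèmes 2.1 and 4.1 give (p. 783) `S₀^{ℓ₀'} S₁^{λ_a'} S_{ℓ₁}^{λ'-λ_a'} ≤ (d!/d₀!) T₀^{d₀'} T₁^{d₁'}`;
"En tenant compte du choix des paramètres … avec l'introduction d'un facteur `log κ` pour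
s'affranchir des constantes.  Si on prend les logarithmes des deux membres de cette inégalité et
qu'on les multiplie par `d₁/log D`, on trouve

(5.3) `((d - 2n) + ε₁(n - d₀) + ε₂(d₀ - n) - ε₃(d + 2d₁))(d₁' + λ')`
      `≤ d₁((d' - ℓ₀') + ε₁(ℓ₀' - d₀') + ε₂(d₀' - ℓ₀' - λ_a') + ε₃(1 + ℓ₀'))`

où `ε₁ = log log D / log D`, `ε₂ = log κ / log D` et `ε₃ = log log κ / log D`.  … si on choisit `κ`
suffisamment grand pour que les nombres `ε₁`, `ε₂/ε₁` et `ε₃/ε₂` soient tous `< (6d(d+λ)+1)⁻¹` …".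

This file PROVES the purely numerical statement behind this passage, in the shape consumed by the
endgame `RoyWaldschmidt1997.h51sub_clause_of_ineq53` (`…Sec5Endgame.lean`): writing
`α = d₁(d' - ℓ₀') - (d - 2n)(d₁' + λ')`, `β = d₁(ℓ₀' - d₀') - (n - d₀)(d₁' + λ')`, `γ = d₁λ_a'`,
for `κ ≥ κ₀` and `D ≥ D₀(κ)` the parameters are positive integers, the numbers
`ε₁, ε₂, ε₃` satisfy `0 < ε₃`, `4Bε₃ ≤ ε₂`, `4Bε₂ ≤ ε₁`, `4Bε₁ ≤ 1`, and the displayed product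
inequality implies `0 ≤ α + ε₁β - ε₂(β + γ) + ε₃δ` for a real `δ ≤ B`
(`RoyWaldschmidt1997.Sec5.ineq53_of_product`).  Everything is explicit (`κ₀ = exp(64B² + …)`,
`D₀(κ) = exp(κ^{4B} + …)`); the thresholds are ours, the paper only says "assez grand".

Definitions (with bodies): the parameter functions `Sec5.T0`, `Sec5.Theta`, `Sec5.T1`, `Sec5.S1`,
`Sec5.S2` of `(d₀, d₁, n, κ, D)`.  No named facts.

## References

* [RoyWaldschmidt1997ENS] D. Roy, M. Waldschmidt, Ann. Sci. ÉNS (4) 30 (1997) 753–796, proof of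
  Théorème 5.1, pp. 781–784 (read on the rendered scan).
-/

noncomputable section

open Real

namespace Literature.NumberTheory.Transcendental

namespace RoyWaldschmidt1997

namespace Sec5

/-! ### The parameters (p. 781) -/

/-- `T₀ = S₀ = [κD/((log κ)(log D))]`. [cite: RoyWaldschmidt1997ENS, proof of Théorème 5.1, p. 781] -/
def T0 (κ : ℝ) (D : ℕ) : ℕ := ⌊κ * D / (Real.log κ * Real.log D)⌋₊

/-- `Θ = (log κ)^d κ^{n-d₀} (log D)^{d₀-n} D^{2n-d₀}` (so that `T₁ = [Θ^{1/d₁}]`; here `n ≥ d₀`).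
[cite: RoyWaldschmidt1997ENS, proof of Théorème 5.1, p. 781] -/
def Theta (d₀ d₁ n : ℕ) (κ : ℝ) (D : ℕ) : ℝ :=
  Real.log κ ^ (d₀ + d₁) * κ ^ (n - d₀) * (D : ℝ) ^ (2 * n - d₀) / Real.log D ^ (n - d₀)

/-- `T₁ = ⋯ = T_{d₁} = [Θ^{1/d₁}]`. [cite: RoyWaldschmidt1997ENS, proof of Théorème 5.1, p. 781] -/
def T1 (d₀ d₁ n : ℕ) (κ : ℝ) (D : ℕ) : ℕ := ⌊Theta d₀ d₁ n κ D ^ (1 / (d₁ : ℝ))⌋₊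

/-- `S₁ = ⋯ = S_{ℓ_a} = [κD/((log κ)² T₁)]`. [cite: RoyWaldschmidt1997ENS, proof of Théorème 5.1, p. 781] -/
def S1 (d₀ d₁ n : ℕ) (κ : ℝ) (D : ℕ) : ℕ := ⌊κ * D / (Real.log κ ^ 2 * T1 d₀ d₁ n κ D)⌋₊

/-- `S_{ℓ_a+1} = ⋯ = S_{ℓ₁} = [D/((log κ)² T₁)]`. [cite: RoyWaldschmidt1997ENS, proof of Théorème 5.1, p. 781] -/
def S2 (d₀ d₁ n : ℕ) (κ : ℝ) (D : ℕ) : ℕ := ⌊(D : ℝ) / (Real.log κ ^ 2 * T1 d₀ d₁ n κ D)⌋₊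

/-! ### Elementary real estimates -/

/-- For `B ≥ 1` and `x ≥ 64B²`: `log x ≤ x/(4B)`. [folklore] -/
theorem log_le_div_of_ge {B x : ℝ} (hB : 1 ≤ B) (hx : 64 * B ^ 2 ≤ x) : Real.log x ≤ x / (4 * B) := by
  have hxpos : 0 < x := lt_of_lt_of_le (by positivity) hx
  have hs : Real.log x ≤ 2 * Real.sqrt x := by
    have h1 : Real.log (Real.sqrt x) ≤ Real.sqrt x - 1 := Real.log_le_sub_one_of_pos (Real.sqrt_pos.mpr hxpos)
    have h2 : Real.log x = 2 * Real.log (Real.sqrt x) := by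
      conv_lhs => rw [← Real.sq_sqrt hxpos.le]
      rw [Real.log_pow]; norm_num
    rw [h2]; linarith
  have hsq : 8 * B ≤ Real.sqrt x := by
    rw [show (8 : ℝ) * B = Real.sqrt ((8 * B) ^ 2) by rw [Real.sqrt_sq (by positivity)]]
    exact Real.sqrt_le_sqrt (by nlinarith)
  have hx' : x = Real.sqrt x * Real.sqrt x := (Real.mul_self_sqrt hxpos.le).symm
  rw [le_div_iff₀ (by positivity)]
  nlinarith [Real.sqrt_nonneg x]

/-- For `x ≥ 2`: `log x - log 2 ≤ log ⌊x⌋₊`. [folklore] -/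
theorem log_sub_log_two_le_log_floor {x : ℝ} (hx : 2 ≤ x) : Real.log x - Real.log 2 ≤ Real.log (⌊x⌋₊ : ℝ) := by
  have h1 : x / 2 ≤ (⌊x⌋₊ : ℝ) := by
    have := Nat.sub_one_lt_floor x
    linarith
  have h2 : Real.log (x / 2) ≤ Real.log (⌊x⌋₊ : ℝ) := Real.log_le_log (by positivity) h1
  rwa [Real.log_div (by positivity) (by norm_num)] at h2

/-- For `x ≥ 1`: `log ⌊x⌋₊ ≤ log x`. [folklore] -/
theorem log_floor_le {x : ℝ} (hx : 1 ≤ x) : Real.log (⌊x⌋₊ : ℝ) ≤ Real.log x :=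
  Real.log_le_log (by exact_mod_cast Nat.floor_pos.mpr hx) (Nat.floor_le (by linarith))

/-- For `x ≥ 1`: `1 ≤ ⌊x⌋₊`. [folklore] -/
theorem one_le_floor {x : ℝ} (hx : 1 ≤ x) : 1 ≤ ⌊x⌋₊ := Nat.floor_pos.mpr hx

/-- For `x ≥ 1`: `0 ≤ log ⌊x⌋₊`. [folklore] -/
theorem log_floor_nonneg {x : ℝ} (hx : 1 ≤ x) : 0 ≤ Real.log (⌊x⌋₊ : ℝ) :=
  Real.log_nonneg (by exact_mod_cast one_le_floor hx)

/-! ### The algebra of (5.3) -/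

/-- **The algebraic heart of (5.3).**  With `L = log D`, `k = log κ`, `kk = log log κ`,
`LL = log log D` and the real numbers `x₀ = log T₀`-type quantities bounded as in the proof
(`log T₀ ≤ k + L - kk - LL`, `log S₀ ≥ k + L - kk - LL - log 2`, `log S₁ ≥ k + L - 2kk - t`,
`log S₂ ≥ L - 2kk - t - log 2`-type bounds where `d₁ t = d·kk + (n-d₀)k + (2n-d₀)L - (n-d₀)LL`), the
product inequality in logarithmic form gives `0 ≤ α + ε₁β - ε₂(β+γ) + ε₃δ₀ + E/L`.  We state it
with the exact hypotheses used. [cite: RoyWaldschmidt1997ENS, proof of Théorème 5.1, pp. 783–784] -/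
theorem core_algebra {d₀ d₁ n d₀' d₁' ℓ₀' lam' lamA' : ℕ} {L k kk LL t lT0 lS0 lS1 lS2 lT1 C2 E : ℝ}
    (hL : 0 < L) (hlamA : lamA' ≤ lam')
    (ht : (d₁ : ℝ) * t = ((d₀ : ℝ) + d₁) * kk + ((n : ℝ) - d₀) * k + (2 * (n : ℝ) - d₀) * L - ((n : ℝ) - d₀) * LL)
    (hT0 : lT0 ≤ k + L - kk - LL) (hS0 : k + L - kk - LL - C2 ≤ lS0) (hT1 : lT1 ≤ t)
    (hS1 : k + L - 2 * kk - t - C2 ≤ lS1) (hS2 : L - 2 * kk - t - C2 ≤ lS2)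
    (hprod : ℓ₀' * lS0 + lamA' * lS1 + ((lam' : ℝ) - lamA') * lS2 ≤ E + d₀' * lT0 + d₁' * lT1) :
    0 ≤ ((d₁ : ℝ) * (((d₀' : ℝ) + d₁') - ℓ₀') - (((d₀ : ℝ) + d₁) - 2 * n) * ((d₁' : ℝ) + lam'))
      + (LL / L) * ((d₁ : ℝ) * ((ℓ₀' : ℝ) - d₀') - ((n : ℝ) - d₀) * ((d₁' : ℝ) + lam'))
      - (k / L) * (((d₁ : ℝ) * ((ℓ₀' : ℝ) - d₀') - ((n : ℝ) - d₀) * ((d₁' : ℝ) + lam')) + (d₁ : ℝ) * lamA')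
      + (kk / L) * ((d₁ : ℝ) * ((ℓ₀' : ℝ) - d₀' + 2 * lam') + ((d₀ : ℝ) + d₁) * ((lam' : ℝ) + d₁'))
      + (d₁ * E + d₁ * (((ℓ₀' : ℝ) + lam') * C2)) / L := by
  have hlamR : (lamA' : ℝ) ≤ lam' := by exact_mod_cast hlamA
  have hd₁R : (0 : ℝ) ≤ d₁ := Nat.cast_nonneg _
  -- lower bound the left side of `hprod`, upper bound the right side
  have hℓ : (ℓ₀' : ℝ) * (k + L - kk - LL - C2) ≤ ℓ₀' * lS0 := mul_le_mul_of_nonneg_left hS0 (Nat.cast_nonneg _)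
  have hA : (lamA' : ℝ) * (k + L - 2 * kk - t - C2) ≤ lamA' * lS1 := mul_le_mul_of_nonneg_left hS1 (Nat.cast_nonneg _)
  have hB : ((lam' : ℝ) - lamA') * (L - 2 * kk - t - C2) ≤ ((lam' : ℝ) - lamA') * lS2 :=
    mul_le_mul_of_nonneg_left hS2 (by linarith)
  have hC : (d₀' : ℝ) * lT0 ≤ d₀' * (k + L - kk - LL) := mul_le_mul_of_nonneg_left hT0 (Nat.cast_nonneg _)
  have hD : (d₁' : ℝ) * lT1 ≤ d₁' * t := mul_le_mul_of_nonneg_left hT1 (Nat.cast_nonneg _)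
  have main : (ℓ₀' : ℝ) * (k + L - kk - LL - C2) + lamA' * (k + L - 2 * kk - t - C2) +
      ((lam' : ℝ) - lamA') * (L - 2 * kk - t - C2) ≤ E + d₀' * (k + L - kk - LL) + d₁' * t := by linarith
  -- the target, multiplied by `L`, is `d₁ · (RHS - LHS)` of `main` once `d₁ t` is substituted
  set X : ℝ := ((d₁ : ℝ) * (((d₀' : ℝ) + d₁') - ℓ₀') - (((d₀ : ℝ) + d₁) - 2 * n) * ((d₁' : ℝ) + lam'))
      + (LL / L) * ((d₁ : ℝ) * ((ℓ₀' : ℝ) - d₀') - ((n : ℝ) - d₀) * ((d₁' : ℝ) + lam'))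
      - (k / L) * (((d₁ : ℝ) * ((ℓ₀' : ℝ) - d₀') - ((n : ℝ) - d₀) * ((d₁' : ℝ) + lam')) + (d₁ : ℝ) * lamA')
      + (kk / L) * ((d₁ : ℝ) * ((ℓ₀' : ℝ) - d₀' + 2 * lam') + ((d₀ : ℝ) + d₁) * ((lam' : ℝ) + d₁'))
      + (d₁ * E + d₁ * (((ℓ₀' : ℝ) + lam') * C2)) / L with hX
  have hLne : L ≠ 0 := hL.ne'
  have e : L * X = (d₁ : ℝ) * ((E + d₀' * (k + L - kk - LL) + d₁' * t) -
        ((ℓ₀' : ℝ) * (k + L - kk - LL - C2) + lamA' * (k + L - 2 * kk - t - C2) +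
          ((lam' : ℝ) - lamA') * (L - 2 * kk - t - C2)))
      - ((d₁' : ℝ) + lam') * ((d₁ : ℝ) * t -
        (((d₀ : ℝ) + d₁) * kk + ((n : ℝ) - d₀) * k + (2 * (n : ℝ) - d₀) * L - ((n : ℝ) - d₀) * LL)) := by
    rw [hX]
    field_simp
    ring
  have hLX : 0 ≤ L * X := by
    rw [e, ht, sub_self, mul_zero, sub_zero]
    exact mul_nonneg hd₁R (sub_nonneg.mpr main)
  by_contra hneg
  have : L * X < 0 := mul_neg_of_pos_of_neg hL (not_le.mp hneg)
  linarith

/-! ### The logarithm of `Θ` -/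

/-- `log Θ = d·log log κ + (n-d₀) log κ + (2n-d₀) log D - (n-d₀) log log D` (for `κ > 1`, `D > 1`,
`n ≥ d₀`). [folklore] -/
theorem log_Theta {d₀ d₁ n : ℕ} {κ : ℝ} {D : ℕ} (hκ : 1 < κ) (hD : 1 < (D : ℝ)) (hd₀n : d₀ ≤ n) :
    Real.log (Theta d₀ d₁ n κ D) = ((d₀ : ℝ) + d₁) * Real.log (Real.log κ) + ((n : ℝ) - d₀) * Real.log κ +
      (2 * (n : ℝ) - d₀) * Real.log D - ((n : ℝ) - d₀) * Real.log (Real.log D) := by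
  have hk : 0 < Real.log κ := Real.log_pos hκ
  have hL : 0 < Real.log D := Real.log_pos hD
  have hD0 : (0 : ℝ) < D := by linarith
  rw [Theta, Real.log_div (by positivity) (by positivity), Real.log_mul (by positivity) (by positivity),
    Real.log_mul (by positivity) (by positivity), Real.log_pow, Real.log_pow, Real.log_pow, Real.log_pow]
  have h2n : d₀ ≤ 2 * n := by omega
  push_cast [Nat.cast_sub hd₀n, Nat.cast_sub h2n]
  ring

/-- `Θ > 0` (for `κ > 1`, `D > 1`). [folklore] -/
theorem Theta_pos {d₀ d₁ n : ℕ} {κ : ℝ} {D : ℕ} (hκ : 1 < κ) (hD : 1 < (D : ℝ)) : 0 < Theta d₀ d₁ n κ D := by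
  have hk : 0 < Real.log κ := Real.log_pos hκ
  have hL : 0 < Real.log D := Real.log_pos hD
  have hD0 : (0 : ℝ) < D := by linarith
  rw [Theta]; positivity

/-- `log Θ ≥ 0` when moreover `κ ≥ e` and `D ≥ e`, `0 < n`. [folklore] -/
theorem log_Theta_nonneg {d₀ d₁ n : ℕ} {κ : ℝ} {D : ℕ} (hκ : Real.exp 1 ≤ κ) (hD : Real.exp 1 ≤ (D : ℝ))
    (hd₀n : d₀ ≤ n) : 0 ≤ Real.log (Theta d₀ d₁ n κ D) := by
  have he : (1 : ℝ) < Real.exp 1 := by have := Real.exp_one_gt_d9; linarith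
  have hκ1 : 1 < κ := lt_of_lt_of_le he hκ
  have hD1 : 1 < (D : ℝ) := lt_of_lt_of_le he hD
  rw [log_Theta hκ1 hD1 hd₀n]
  have hk1 : 1 ≤ Real.log κ := by rw [← Real.log_exp 1]; exact Real.log_le_log (Real.exp_pos 1) hκ
  have hL1 : 1 ≤ Real.log D := by rw [← Real.log_exp 1]; exact Real.log_le_log (Real.exp_pos 1) hD
  have hkk : 0 ≤ Real.log (Real.log κ) := Real.log_nonneg hk1
  have hLL : Real.log (Real.log D) ≤ Real.log D := (Real.log_le_sub_one_of_pos (by linarith)).trans (by linarith)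
  have hLL0 : 0 ≤ Real.log (Real.log D) := Real.log_nonneg hL1
  have hd₀nR : (d₀ : ℝ) ≤ n := by exact_mod_cast hd₀n
  have hnd : (0 : ℝ) ≤ (n : ℝ) - d₀ := by linarith
  have hn0 : (0 : ℝ) ≤ n := Nat.cast_nonneg _
  have h1 : ((n : ℝ) - d₀) * Real.log (Real.log D) ≤ ((n : ℝ) - d₀) * Real.log D :=
    mul_le_mul_of_nonneg_left hLL hnd
  have h2 : ((n : ℝ) - d₀) * Real.log D ≤ (2 * (n : ℝ) - d₀) * Real.log D :=
    mul_le_mul_of_nonneg_right (by linarith) (by linarith)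
  have h3 : 0 ≤ ((d₀ : ℝ) + d₁) * Real.log (Real.log κ) := mul_nonneg (by positivity) hkk
  have h4 : 0 ≤ ((n : ℝ) - d₀) * Real.log κ := mul_nonneg hnd (by linarith)
  linarith

/-! ### The main numerical statement -/

set_option maxHeartbeats 1600000 in
/-- **The parameters of §5 and inequality (5.3)** (Roy–Waldschmidt 1997, pp. 781–784): for
`n > 0`, `n ≥ d₀`, `d = d₀ + d₁ > 2n`, `d₁ > 0`, a constant `C ≥ 1` (in the paper `C = d!/d₀!`), `λ`
and `B ≥ d(n + 3λ + d + 1) + 1`, there is `κ₀` such that for every `κ ≥ κ₀` there is `D₀` such that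
for every `D ≥ D₀`: the parameters `T₀ = S₀`, `T₁`, `S₁`, `S_{ℓ₁}` are `≥ 1` with `S_{ℓ₁} ≤ S₁`, and
there are reals `0 < ε₃`, `4Bε₃ ≤ ε₂`, `4Bε₂ ≤ ε₁`, `4Bε₁ ≤ 1` (namely `ε₁ = log log D/log D`,
`ε₂ = log κ/log D`, `ε₃ = log log κ/log D`) such that for all `d₀' ≤ d₀`, `d₁' ≤ d₁`, `ℓ₀' ≤ n`,
`λ_a' ≤ λ' ≤ λ`, the product inequality `S₀^{ℓ₀'} S₁^{λ_a'} S_{ℓ₁}^{λ'-λ_a'} ≤ C T₀^{d₀'} T₁^{d₁'}`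
implies `0 ≤ α + ε₁β - ε₂(β + γ) + ε₃δ` for some real `δ ≤ B`, where
`α = d₁(d' - ℓ₀') - (d - 2n)(d₁' + λ')`, `β = d₁(ℓ₀' - d₀') - (n - d₀)(d₁' + λ')`, `γ = d₁λ_a'`
(this is (5.3) in the form used by the endgame, p. 784).
[cite: RoyWaldschmidt1997ENS, proof of Théorème 5.1, pp. 781–784] -/
theorem ineq53_of_product (d₀ d₁ n lam C B : ℕ) (hn : 0 < n) (hd₀n : d₀ ≤ n) (h2n : 2 * n < d₀ + d₁)
    (hd₁ : 0 < d₁) (hC : 1 ≤ C) (hB : (d₀ + d₁) * (n + 3 * lam + (d₀ + d₁) + 1) + 1 ≤ B) :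
    ∃ κ₀ : ℝ, Real.exp 3 ≤ κ₀ ∧ ∀ κ : ℝ, κ₀ ≤ κ → ∃ D₀ : ℕ, 3 ≤ D₀ ∧ ∀ D : ℕ, D₀ ≤ D →
      (1 ≤ T0 κ D ∧ 1 ≤ T1 d₀ d₁ n κ D ∧ 1 ≤ S2 d₀ d₁ n κ D ∧ S2 d₀ d₁ n κ D ≤ S1 d₀ d₁ n κ D) ∧
      ∃ ε₁ ε₂ ε₃ : ℝ, 0 < ε₃ ∧ 4 * B * ε₃ ≤ ε₂ ∧ 4 * B * ε₂ ≤ ε₁ ∧ 4 * B * ε₁ ≤ 1 ∧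
        ∀ d₀' d₁' ℓ₀' lam' lamA' : ℕ, d₀' ≤ d₀ → d₁' ≤ d₁ → ℓ₀' ≤ n → lamA' ≤ lam' → lam' ≤ lam →
          T0 κ D ^ ℓ₀' * S1 d₀ d₁ n κ D ^ lamA' * S2 d₀ d₁ n κ D ^ (lam' - lamA') ≤
            C * T0 κ D ^ d₀' * T1 d₀ d₁ n κ D ^ d₁' →
          ∃ δ : ℝ, δ ≤ B ∧
            0 ≤ ((d₁ : ℝ) * (((d₀' : ℝ) + d₁') - ℓ₀') - (((d₀ : ℝ) + d₁) - 2 * n) * ((d₁' : ℝ) + lam'))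
              + ε₁ * ((d₁ : ℝ) * ((ℓ₀' : ℝ) - d₀') - ((n : ℝ) - d₀) * ((d₁' : ℝ) + lam'))
              - ε₂ * (((d₁ : ℝ) * ((ℓ₀' : ℝ) - d₀') - ((n : ℝ) - d₀) * ((d₁' : ℝ) + lam')) + (d₁ : ℝ) * lamA')
              + ε₃ * δ := by
  -- constants
  have hB1 : (1 : ℝ) ≤ B := by
    have : 1 ≤ B := le_trans (Nat.le_add_left 1 _) hB
    exact_mod_cast this
  set c₁ : ℝ := (d₁ : ℝ) * (Real.log C + ((n : ℝ) + lam) * Real.log 2) + 1 with hc₁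
  have hc₁pos : 0 < c₁ := by
    have : 0 ≤ (d₁ : ℝ) * (Real.log C + ((n : ℝ) + lam) * Real.log 2) :=
      mul_nonneg (Nat.cast_nonneg _) (add_nonneg (Real.log_nonneg (by exact_mod_cast hC))
        (mul_nonneg (by positivity) (Real.log_nonneg (by norm_num))))
    linarith
  -- `k₀`: lower bound for `k = log κ`
  set k₀ : ℝ := 64 * (B : ℝ) ^ 2 + Real.exp c₁ + 3 with hk₀
  have hB2 : (0 : ℝ) ≤ 64 * (B : ℝ) ^ 2 := by positivity
  have hec₁ : 0 < Real.exp c₁ := Real.exp_pos _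
  have hk₀3 : 3 ≤ k₀ := by rw [hk₀]; linarith
  refine ⟨Real.exp k₀, Real.exp_le_exp.mpr hk₀3, fun κ hκ => ?_⟩
  -- facts about `k = log κ`, `kk = log log κ`
  have hκpos : 0 < κ := lt_of_lt_of_le (Real.exp_pos _) hκ
  set k : ℝ := Real.log κ with hk
  have hk₀k : k₀ ≤ k := by rw [hk, ← Real.log_exp k₀]; exact Real.log_le_log (Real.exp_pos _) hκ
  have hk3 : 3 ≤ k := le_trans hk₀3 hk₀k
  have hkB : 64 * (B : ℝ) ^ 2 ≤ k := le_trans (by rw [hk₀]; linarith) hk₀k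
  have hkc : Real.exp c₁ ≤ k := le_trans (by rw [hk₀]; linarith) hk₀k
  have hκe : Real.exp 1 ≤ κ := le_trans (Real.exp_le_exp.mpr (by linarith)) hκ
  have hκ1 : 1 < κ := lt_of_lt_of_le (by have := Real.exp_one_gt_d9; linarith) hκe
  set kk : ℝ := Real.log k with hkk
  have hkk1 : 1 ≤ kk := by
    rw [hkk]
    have h3 : Real.log 3 ≤ Real.log k := Real.log_le_log (by norm_num) hk3
    have he3 : 1 < Real.log 3 := by
      rw [← Real.log_exp 1]
      exact Real.log_lt_log (Real.exp_pos 1) (by have := Real.exp_one_lt_d9; linarith)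
    linarith
  have hkkc : c₁ ≤ kk := by rw [hkk, ← Real.log_exp c₁]; exact Real.log_le_log (Real.exp_pos _) hkc
  have hkk_small : kk ≤ k / (4 * B) := log_le_div_of_ge hB1 hkB
  -- `L₀`: lower bound for `L = log D`
  set c₂ : ℝ := (d₁ : ℝ) * (Real.log 2 + 2 * kk) + ((d₀ : ℝ) + d₁) * kk + ((n : ℝ) - d₀) * k with hc₂
  set L₀ : ℝ := 64 * (B : ℝ) ^ 2 + Real.exp (4 * B * k) + c₂ + 3 with hL₀
  have hc₂nn : 0 ≤ c₂ := by
    have hd₀nR : (d₀ : ℝ) ≤ n := by exact_mod_cast hd₀n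
    have hlog2 : 0 ≤ Real.log 2 := Real.log_nonneg (by norm_num)
    have t1 : 0 ≤ (d₁ : ℝ) * (Real.log 2 + 2 * kk) := mul_nonneg (Nat.cast_nonneg _) (by linarith)
    have t2 : 0 ≤ ((d₀ : ℝ) + d₁) * kk := mul_nonneg (by positivity) (by linarith)
    have t3 : 0 ≤ ((n : ℝ) - d₀) * k := mul_nonneg (by linarith) (by linarith)
    rw [hc₂]; linarith
  have hexp4 : 0 < Real.exp (4 * B * k) := Real.exp_pos _
  have hL₀3 : 3 ≤ L₀ := by rw [hL₀]; linarith
  set D₀ : ℕ := ⌈Real.exp L₀⌉₊ + ⌈16 * k ^ 2⌉₊ + 3 with hD₀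
  refine ⟨D₀, by rw [hD₀]; omega, fun D hD => ?_⟩
  -- facts about `L = log D`, `LL = log log D`
  have hDR : (D₀ : ℝ) ≤ D := by exact_mod_cast hD
  have hD₀R : (D₀ : ℝ) = (⌈Real.exp L₀⌉₊ : ℝ) + (⌈16 * k ^ 2⌉₊ : ℝ) + 3 := by rw [hD₀]; push_cast; ring
  have hceil1 : Real.exp L₀ ≤ (⌈Real.exp L₀⌉₊ : ℝ) := Nat.le_ceil _
  have hceil2 : 16 * k ^ 2 ≤ (⌈16 * k ^ 2⌉₊ : ℝ) := Nat.le_ceil _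
  have hceil1nn : (0 : ℝ) ≤ (⌈Real.exp L₀⌉₊ : ℝ) := Nat.cast_nonneg _
  have hceil2nn : (0 : ℝ) ≤ (⌈16 * k ^ 2⌉₊ : ℝ) := Nat.cast_nonneg _
  have hD₀exp : Real.exp L₀ ≤ D := by linarith
  have hD16 : 16 * k ^ 2 ≤ D := by linarith
  have hDpos : (0 : ℝ) < D := lt_of_lt_of_le (Real.exp_pos _) hD₀exp
  set L : ℝ := Real.log D with hLdef
  have hL₀L : L₀ ≤ L := by
    rw [hLdef, ← Real.log_exp L₀]; exact Real.log_le_log (Real.exp_pos _) hD₀exp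
  have hL3 : 3 ≤ L := le_trans hL₀3 hL₀L
  have hLB : 64 * (B : ℝ) ^ 2 ≤ L := le_trans (by rw [hL₀]; linarith) hL₀L
  have hLexp : Real.exp (4 * B * k) ≤ L := le_trans (by rw [hL₀]; linarith) hL₀L
  have hLc₂ : c₂ + 3 ≤ L := le_trans (by rw [hL₀]; linarith) hL₀L
  have hDe : Real.exp 1 ≤ (D : ℝ) := le_trans (Real.exp_le_exp.mpr (by linarith)) hD₀exp
  have hD1 : 1 < (D : ℝ) := lt_of_lt_of_le (by have := Real.exp_one_gt_d9; linarith) hDe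
  set LL : ℝ := Real.log L with hLL
  have hLL0 : 0 ≤ LL := Real.log_nonneg (by linarith)
  have hLLL : LL ≤ L := (Real.log_le_sub_one_of_pos (by linarith)).trans (by linarith)
  have hLL_small : LL ≤ L / (4 * B) := log_le_div_of_ge hB1 hLB
  have hLL_big : 4 * B * k ≤ LL := by
    rw [hLL, ← Real.log_exp (4 * B * k)]; exact Real.log_le_log (Real.exp_pos _) hLexp
  have hLpos : 0 < L := by linarith
  -- the real parameters
  set x₀ : ℝ := κ * D / (Real.log κ * Real.log D) with hx₀
  have hx₀' : x₀ = κ * D / (k * L) := by rw [hx₀]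
  set θ : ℝ := Theta d₀ d₁ n κ D with hθ
  have hθpos : 0 < θ := Theta_pos hκ1 hD1
  set t₁ : ℝ := θ ^ (1 / (d₁ : ℝ)) with ht₁
  have ht₁pos : 0 < t₁ := Real.rpow_pos_of_pos hθpos _
  set t : ℝ := Real.log t₁ with htdef
  have hd₁R : (0 : ℝ) < d₁ := by exact_mod_cast hd₁
  have ht_eq : (d₁ : ℝ) * t = ((d₀ : ℝ) + d₁) * kk + ((n : ℝ) - d₀) * k + (2 * (n : ℝ) - d₀) * L - ((n : ℝ) - d₀) * LL := by
    rw [htdef, ht₁, Real.log_rpow hθpos, hθ, log_Theta hκ1 hD1 hd₀n, ← hk, ← hLdef, ← hkk, ← hLL]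
    field_simp
  have hlogθ : 0 ≤ Real.log θ := log_Theta_nonneg hκe hDe hd₀n
  have ht1_ge : 1 ≤ t₁ := by
    rw [ht₁]
    have : θ ^ (1 / (d₁ : ℝ)) ≥ 1 ^ (1 / (d₁ : ℝ)) :=
      Real.rpow_le_rpow (by norm_num) (by
        have := Real.exp_log hθpos
        have h1 : Real.exp 0 ≤ Real.exp (Real.log θ) := Real.exp_le_exp.mpr hlogθ
        rw [Real.exp_zero] at h1; linarith) (by positivity)
    simpa using this
  have hT1_le : (T1 d₀ d₁ n κ D : ℝ) ≤ t₁ := by rw [T1]; exact Nat.floor_le ht₁pos.le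
  have hT1_ge : 1 ≤ T1 d₀ d₁ n κ D := by rw [T1]; exact one_le_floor ht1_ge
  have hT1R : (1 : ℝ) ≤ T1 d₀ d₁ n κ D := by exact_mod_cast hT1_ge
  -- `t ≤ (c₂ - d₁ log 2 + (d₁ - 1) L)/d₁`-type bound: `log(2 k² t₁) ≤ L`
  have ht_bound : Real.log 2 + 2 * kk + t ≤ L := by
    -- `d₁ t ≤ d kk + (n-d₀) k + (2n-d₀) L ≤ d kk + (n-d₀)k + (d₁ - 1) L`
    have h2n' : (2 * (n : ℝ) - d₀) ≤ (d₁ : ℝ) - 1 := by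
      have : 2 * n + 1 ≤ d₀ + d₁ := h2n
      have : (2 * (n : ℝ) + 1) ≤ (d₀ : ℝ) + d₁ := by exact_mod_cast this
      linarith
    have hd₀nR : (d₀ : ℝ) ≤ n := by exact_mod_cast hd₀n
    have hnd : (0 : ℝ) ≤ (n : ℝ) - d₀ := by linarith
    have h1 : (d₁ : ℝ) * t ≤ ((d₀ : ℝ) + d₁) * kk + ((n : ℝ) - d₀) * k + ((d₁ : ℝ) - 1) * L := by
      rw [ht_eq]
      nlinarith [mul_nonneg hnd hLL0, mul_le_mul_of_nonneg_right h2n' hLpos.le]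
    -- so `d₁ (log 2 + 2kk + t) ≤ c₂ + (d₁ - 1) L ≤ d₁ L` using `c₂ + 3 ≤ L`
    have h2 : (d₁ : ℝ) * (Real.log 2 + 2 * kk + t) ≤ c₂ + ((d₁ : ℝ) - 1) * L := by rw [hc₂]; linarith
    have h3 : c₂ + ((d₁ : ℝ) - 1) * L ≤ (d₁ : ℝ) * L := by linarith
    have h4 : (d₁ : ℝ) * (Real.log 2 + 2 * kk + t) ≤ (d₁ : ℝ) * L := h2.trans h3
    exact le_of_mul_le_mul_left h4 hd₁R
  -- `x₂ = D/(k² T1) ≥ 2`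
  set x₂ : ℝ := (D : ℝ) / (Real.log κ ^ 2 * T1 d₀ d₁ n κ D) with hx₂
  have hkpos : 0 < k := by linarith
  have hx₂_ge : 2 ≤ x₂ := by
    rw [hx₂, le_div_iff₀ (by positivity)]
    -- `2 k² T1 ≤ 2 k² t₁ = exp(log 2 + 2 kk + t) ≤ exp L = D`
    have h1 : 2 * (k ^ 2 * (T1 d₀ d₁ n κ D : ℝ)) ≤ 2 * (k ^ 2 * t₁) := by
      have := mul_le_mul_of_nonneg_left hT1_le (sq_nonneg k); linarith
    have h2 : 2 * (k ^ 2 * t₁) = Real.exp (Real.log 2 + 2 * kk + t) := by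
      rw [Real.exp_add, Real.exp_add, Real.exp_log (by norm_num), htdef, Real.exp_log ht₁pos,
        show (2 : ℝ) * kk = kk + kk by ring, Real.exp_add, hkk, Real.exp_log hkpos]; ring
    have h3 : Real.exp (Real.log 2 + 2 * kk + t) ≤ Real.exp L := Real.exp_le_exp.mpr ht_bound
    have h4 : Real.exp L = D := by rw [hLdef, Real.exp_log hDpos]
    have : Real.log κ = k := rfl
    rw [this]; linarith
  -- `x₁ = κ D/(k² T1) ≥ x₂ ≥ 2`
  set x₁ : ℝ := κ * D / (Real.log κ ^ 2 * T1 d₀ d₁ n κ D) with hx₁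
  have hx₁x₂ : x₂ ≤ x₁ := by
    rw [hx₁, hx₂]
    apply div_le_div_of_nonneg_right _ (by positivity)
    exact le_mul_of_one_le_left hDpos.le hκ1.le
  have hx₁_ge : 2 ≤ x₁ := hx₂_ge.trans hx₁x₂
  -- `x₀ ≥ 2`
  have hx₀_ge : 2 ≤ x₀ := by
    rw [hx₀', le_div_iff₀ (by positivity)]
    -- `2 k L ≤ κ D`: `L ≤ 2 √D`, `4 k √D ≤ D` (as `16 k² ≤ D`), `κ ≥ 1`
    have hs : L ≤ 2 * Real.sqrt D := by
      have h1 : Real.log (Real.sqrt D) ≤ Real.sqrt D - 1 := Real.log_le_sub_one_of_pos (Real.sqrt_pos.mpr hDpos)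
      have h2 : Real.log D = 2 * Real.log (Real.sqrt D) := by
        conv_lhs => rw [← Real.sq_sqrt hDpos.le]
        rw [Real.log_pow]; norm_num
      rw [hLdef, h2]; linarith
    have hsq : 4 * k ≤ Real.sqrt D := by
      rw [show (4 : ℝ) * k = Real.sqrt ((4 * k) ^ 2) by rw [Real.sqrt_sq (by positivity)]]
      exact Real.sqrt_le_sqrt (by nlinarith)
    have hDD : Real.sqrt D * Real.sqrt D = (D : ℝ) := Real.mul_self_sqrt hDpos.le
    have hsD : 0 ≤ Real.sqrt (D : ℝ) := Real.sqrt_nonneg _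
    have h1 : k * L ≤ k * (2 * Real.sqrt D) := mul_le_mul_of_nonneg_left hs hkpos.le
    have h2 : 4 * k * Real.sqrt D ≤ Real.sqrt D * Real.sqrt D := mul_le_mul_of_nonneg_right hsq hsD
    have h3 : 2 * (k * L) ≤ (D : ℝ) := by rw [← hDD]; linarith
    have h4 : (D : ℝ) ≤ κ * D := le_mul_of_one_le_left hDpos.le hκ1.le
    linarith
  -- positivity of the integer parameters
  have hT0_ge : 1 ≤ T0 κ D := by rw [T0]; exact one_le_floor (by linarith)
  have hS2_ge : 1 ≤ S2 d₀ d₁ n κ D := by rw [S2]; exact one_le_floor (by linarith)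
  have hS1_ge : 1 ≤ S1 d₀ d₁ n κ D := by rw [S1]; exact one_le_floor (by linarith)
  have hS2S1 : S2 d₀ d₁ n κ D ≤ S1 d₀ d₁ n κ D := by
    rw [S2, S1]; exact Nat.floor_le_floor hx₁x₂
  -- the `ε`'s
  refine ⟨⟨hT0_ge, hT1_ge, hS2_ge, hS2S1⟩, LL / L, k / L, kk / L, div_pos (by linarith) hLpos, ?_, ?_, ?_, ?_⟩
  · -- `4B kk/L ≤ k/L`
    rw [show 4 * (B : ℝ) * (kk / L) = (4 * B * kk) / L by ring]
    apply div_le_div_of_nonneg_right _ hLpos.le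
    have := (le_div_iff₀ (by positivity : (0:ℝ) < 4 * B)).mp hkk_small
    linarith
  · rw [show 4 * (B : ℝ) * (k / L) = (4 * B * k) / L by ring]
    exact div_le_div_of_nonneg_right hLL_big hLpos.le
  · rw [show 4 * (B : ℝ) * (LL / L) = (4 * B * LL) / L by ring, div_le_one hLpos]
    have := (le_div_iff₀ (by positivity : (0:ℝ) < 4 * B)).mp hLL_small
    linarith
  -- the product inequality
  intro d₀' d₁' ℓ₀' lam' lamA' hd₀' hd₁' hℓ₀' hlamA hlam hprod
  -- logarithms of the parameters
  have lT0_le : Real.log (T0 κ D : ℝ) ≤ k + L - kk - LL := by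
    have h := log_floor_le (show (1:ℝ) ≤ x₀ by linarith)
    have e : Real.log x₀ = k + L - kk - LL := by
      rw [hx₀', Real.log_div (by positivity) (by positivity), Real.log_mul (by positivity) (by positivity),
        Real.log_mul (by positivity) (by positivity), ← hk, ← hLdef, ← hkk, ← hLL]; ring
    rw [T0]; linarith
  have lT0_ge : k + L - kk - LL - Real.log 2 ≤ Real.log (T0 κ D : ℝ) := by
    have h := log_sub_log_two_le_log_floor hx₀_ge
    have e : Real.log x₀ = k + L - kk - LL := by
      rw [hx₀', Real.log_div (by positivity) (by positivity), Real.log_mul (by positivity) (by positivity),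
        Real.log_mul (by positivity) (by positivity), ← hk, ← hLdef, ← hkk, ← hLL]; ring
    rw [T0]; linarith
  have lT1_le : Real.log (T1 d₀ d₁ n κ D : ℝ) ≤ t := by
    rw [htdef]; exact Real.log_le_log (by positivity) hT1_le
  have lT1_nn : 0 ≤ Real.log (T1 d₀ d₁ n κ D : ℝ) := Real.log_nonneg hT1R
  have lS1_ge : k + L - 2 * kk - t - Real.log 2 ≤ Real.log (S1 d₀ d₁ n κ D : ℝ) := by
    have h := log_sub_log_two_le_log_floor hx₁_ge
    have e : Real.log x₁ = k + L - 2 * kk - Real.log (T1 d₀ d₁ n κ D : ℝ) := by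
      rw [hx₁, Real.log_div (by positivity) (by positivity), Real.log_mul (by positivity) (by positivity),
        Real.log_mul (by positivity) (by positivity), Real.log_pow]; push_cast; ring
    rw [S1]; linarith
  have lS2_ge : L - 2 * kk - t - Real.log 2 ≤ Real.log (S2 d₀ d₁ n κ D : ℝ) := by
    have h := log_sub_log_two_le_log_floor hx₂_ge
    have e : Real.log x₂ = L - 2 * kk - Real.log (T1 d₀ d₁ n κ D : ℝ) := by
      rw [hx₂, Real.log_div (by positivity) (by positivity), Real.log_mul (by positivity) (by positivity),
        Real.log_pow]; push_cast; ring
    rw [S2]; linarith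
  -- the product inequality in logarithmic form
  have hprodR : (ℓ₀' : ℝ) * Real.log (T0 κ D : ℝ) + lamA' * Real.log (S1 d₀ d₁ n κ D : ℝ) +
      ((lam' : ℝ) - lamA') * Real.log (S2 d₀ d₁ n κ D : ℝ) ≤
      Real.log C + d₀' * Real.log (T0 κ D : ℝ) + d₁' * Real.log (T1 d₀ d₁ n κ D : ℝ) := by
    have h1 : ((T0 κ D ^ ℓ₀' * S1 d₀ d₁ n κ D ^ lamA' * S2 d₀ d₁ n κ D ^ (lam' - lamA') : ℕ) : ℝ) ≤
        ((C * T0 κ D ^ d₀' * T1 d₀ d₁ n κ D ^ d₁' : ℕ) : ℝ) := by exact_mod_cast hprod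
    have hpos : (0 : ℝ) < ((T0 κ D ^ ℓ₀' * S1 d₀ d₁ n κ D ^ lamA' * S2 d₀ d₁ n κ D ^ (lam' - lamA') : ℕ) : ℝ) := by
      have : 0 < T0 κ D ^ ℓ₀' * S1 d₀ d₁ n κ D ^ lamA' * S2 d₀ d₁ n κ D ^ (lam' - lamA') := by positivity
      exact_mod_cast this
    have h2 := Real.log_le_log hpos h1
    push_cast at h2
    rw [Real.log_mul (by positivity) (by positivity), Real.log_mul (by positivity) (by positivity),
      Real.log_pow, Real.log_pow, Real.log_pow, Real.log_mul (by positivity) (by positivity),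
      Real.log_mul (by positivity) (by positivity), Real.log_pow, Real.log_pow, Nat.cast_sub hlamA] at h2
    linarith
  have key := core_algebra (E := Real.log C) hLpos hlamA ht_eq lT0_le lT0_ge lT1_le lS1_ge lS2_ge hprodR
  -- `δ = δ₀ + d₁ (log C + (ℓ₀' + λ') log 2)/kk`
  set δ₀ : ℝ := (d₁ : ℝ) * ((ℓ₀' : ℝ) - d₀' + 2 * lam') + ((d₀ : ℝ) + d₁) * ((lam' : ℝ) + d₁') with hδ₀
  set Ec : ℝ := (d₁ : ℝ) * Real.log C + d₁ * (((ℓ₀' : ℝ) + lam') * Real.log 2) with hEc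
  have hkkpos : 0 < kk := by linarith
  refine ⟨δ₀ + Ec / kk, ?_, ?_⟩
  · -- `δ ≤ B`
    have hEc_le : Ec ≤ c₁ - 1 := by
      rw [hEc, hc₁]
      have hl2 : 0 ≤ Real.log 2 := Real.log_nonneg (by norm_num)
      have h1 : ((ℓ₀' : ℝ) + lam') ≤ (n : ℝ) + lam := by
        have a : (ℓ₀' : ℝ) ≤ n := by exact_mod_cast hℓ₀'
        have b : (lam' : ℝ) ≤ lam := by exact_mod_cast hlam
        linarith
      have h2 : ((ℓ₀' : ℝ) + lam') * Real.log 2 ≤ ((n : ℝ) + lam) * Real.log 2 := mul_le_mul_of_nonneg_right h1 hl2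
      have h3 : (d₁ : ℝ) * (((ℓ₀' : ℝ) + lam') * Real.log 2) ≤ (d₁ : ℝ) * (((n : ℝ) + lam) * Real.log 2) :=
        mul_le_mul_of_nonneg_left h2 (Nat.cast_nonneg _)
      linarith
    have hE1 : Ec / kk ≤ 1 := by
      rw [div_le_one hkkpos]; linarith
    have hδ₀ : δ₀ ≤ ((d₀ : ℝ) + d₁) * ((n : ℝ) + 3 * lam + ((d₀ : ℝ) + d₁)) := by
      rw [hδ₀]
      have a : (ℓ₀' : ℝ) ≤ n := by exact_mod_cast hℓ₀'
      have b : (lam' : ℝ) ≤ lam := by exact_mod_cast (hlam)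
      have c : (d₁' : ℝ) ≤ d₁ := by exact_mod_cast hd₁'
      have e1 : (d₁ : ℝ) * ((ℓ₀' : ℝ) - d₀' + 2 * lam') ≤ ((d₀ : ℝ) + d₁) * ((n : ℝ) + 2 * lam) := by
        have : (ℓ₀' : ℝ) - d₀' + 2 * lam' ≤ (n : ℝ) + 2 * lam := by
          have : (0 : ℝ) ≤ d₀' := Nat.cast_nonneg _; linarith
        calc (d₁ : ℝ) * ((ℓ₀' : ℝ) - d₀' + 2 * lam') ≤ (d₁ : ℝ) * ((n : ℝ) + 2 * lam) :=
              mul_le_mul_of_nonneg_left this (Nat.cast_nonneg _)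
          _ ≤ ((d₀ : ℝ) + d₁) * ((n : ℝ) + 2 * lam) := by
              apply mul_le_mul_of_nonneg_right _ (by positivity)
              have : (0:ℝ) ≤ d₀ := Nat.cast_nonneg _; linarith
      have e2 : ((d₀ : ℝ) + d₁) * ((lam' : ℝ) + d₁') ≤ ((d₀ : ℝ) + d₁) * ((lam : ℝ) + ((d₀ : ℝ) + d₁)) := by
        apply mul_le_mul_of_nonneg_left _ (by positivity)
        have : (0:ℝ) ≤ d₀ := Nat.cast_nonneg _; linarith
      linarith
    have hBR : ((d₀ : ℝ) + d₁) * ((n : ℝ) + 3 * lam + ((d₀ : ℝ) + d₁) + 1) + 1 ≤ B := by exact_mod_cast hB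
    have hdd : (0:ℝ) ≤ (d₀ : ℝ) + d₁ := by positivity
    linarith
  · -- the inequality: `ε₃ δ = (kk/L) δ₀ + Ec/L`
    have e : kk / L * (δ₀ + Ec / kk) = kk / L * δ₀ + ((d₁ : ℝ) * Real.log C + d₁ * (((ℓ₀' : ℝ) + lam') * Real.log 2)) / L := by
      rw [hEc]; field_simp
    rw [e]
    have := key
    rw [hδ₀]
    linarith [key]

end Sec5

end RoyWaldschmidt1997

end Literature.NumberTheory.Transcendental
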